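import Mathlib
import Literature.Analysis.FluidPDE.BiotSavartDivCurl
import Literature.Analysis.FluidPDE.BiotSavartGradientLp
import Literature.Analysis.FluidPDE.BiotSavartBounds
import Literature.Analysis.FluidPDE.VectorCalculusProofs
import Literature.Analysis.FluidPDE.ClassicalSolution
import Summits.NavierStokesRegularity.NavierStokesRegularity.Theorems.EulerZoomLiouvillePowerGaugeEulerLiouvilleSelfSimilarIrrotationalGrowth
import Summits.NavierStokesRegularity.NavierStokesRegularity.Theorems.EulerZoomLiouvillePowerGaugeEulerLiouvilleSelfSimilarPastExtension
import HarnessLib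

/-!
# A classical slice with compactly supported vorticity IS its Biot–Savart field (the `A`-gauge as the decay condition)
# (crux `EulerZoomLiouville.PowerGaugeEulerLiouville` = stmt-NavierStokesRegularity-19832; line `vortex-volume` of ns-idea-11, stub V1
# `stub_biotSavartSlice` — filler)

Route `EulerZoomLiouville` (NavierStokesRegularity); width seat ns-ezl-w1 on the interim LEAD ns-typeII-p2 g10's assignment (2026-08-28T05:45:47Z,
chain V2 → V1 → V1b → V3).  The Biot–Savart representation `v = K₃ ∗ curl v` of a smooth divergence-free field on `ℝ³` with compactly supported
curl needs a condition at infinity; the tree has it for `v → 0` (`biotSavart_curl_eq_self`) and for `v ∈ L²`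
(`biotSavart_curl_eq_self_of_lintegral_sq_lt_top`).  Here the condition is SUB-VOLUME GROWTH OF THE BALL ENERGY, `∫_{B_L}|v|² ≤ C L^θ`
(`θ < 3`, large `L`) — exactly what the `A`-gauge `a^{2ρ}A(a;0) ≤ c` of the crux gives on every slice of a member (`θ = 1 − 2ρ`):

* `CompactVortex.contDiff_biotSavart_of_contDiff_of_hasCompactSupport` — `K₃ ∗ W ∈ C^∞` for `W ∈ C^∞_c` (componentwise
  `(K₃ ∗ W)ᵢ = −N[(curl W)ᵢ]`, tree `biotSavart_apply_eq_neg_convolution_curl_apply` + `contDiff_convolution_newtonKernel`);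
* `CompactVortex.eq_biotSavart_curl_of_growth` — `v ∈ C^∞`, `div v = 0`, `curl v` compactly supported, `∫_{B_L}|v|² ≤ C L^θ` for `L ≥ L₀`
  with `C < ∞`, `θ < 3` ⇒ `v = K₃ ∗ curl v` (the remainder `w = v − K₃ ∗ curl v` is `C^∞`, curl- and divergence-free — tree
  `curl_biotSavart_holds`, `divergence_biotSavart_holds`, `div curl = 0` —, with `∫_{B_L}|w|² ≤ 2C L^θ + 2‖K₃ ∗ curl v‖₂²`
  (`eEnergy_biotSavart_lt_top`), hence `0` by the growth Liouville theorem `Loc.eq_zero_of_curl_eq_zero_of_growth`);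
* `CompactVortex.slice_eq_biotSavart_curl` — MEMBER LEVEL: crux hypotheses verbatim (any `ρ ≥ 0`) + `IsClassicalEulerSolutionOn (Iio 0) 0 u p`
  + `τ < 0` + `HasCompactSupport (curl (u τ))` ⇒ `u τ = biotSavart (curl (u τ))` — the line's `Sig.stub_biotSavartSlice` with `InClass` unfolded
  (the `A`-gauge on the slice `τ ∈ (−a², 0)` gives `∫_{B_a}|u(τ)|² ≤ c a^{1−2ρ}` for `a ≥ 1 − τ`).

WHAT THIS IS NOT: not NS, not E, not V3 — one M-sized stratum tool `--supports` stmt-19832. [folklore; MajdaBertozziCUP2002 §2.4.1 Prop. 2.16]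
-/

noncomputable section

-- flat `Theorems/<Route><Decl>…` files of one crux share the namespace of the crux (tree convention: `Summit.<S>.<S>.…`)
set_option linter.dupNamespace false

open MeasureTheory Set Filter Topology Metric Function TopologicalSpace
open scoped ENNReal NNReal Convolution ContDiff

namespace Summit.NavierStokesRegularity.NavierStokesRegularity.Theorems.PowerGaugeEulerLiouville

open Literature.Analysis Literature.Analysis.FunctionSpaces Literature.Analysis.FluidPDE

namespace CompactVortex

/-! ### Smoothness of the Biot–Savart field of a test vorticity -/

/-- **`K₃ ∗ W ∈ C^∞(ℝ³)` for `W ∈ C^∞_c(ℝ³; ℝ³)`** (componentwise `(K₃ ∗ W)ᵢ = −N[(curl W)ᵢ]`, the Newtonian potential of a test density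
is smooth). [cite: MajdaBertozziCUP2002, §2.4.1 Prop. 2.16 with (2.92)–(2.94)] -/
theorem contDiff_biotSavart_of_contDiff_of_hasCompactSupport
    {W : EuclideanSpace ℝ (Fin 3) → EuclideanSpace ℝ (Fin 3)} (hW : ContDiff ℝ ∞ W) (hWc : HasCompactSupport W) :
    ContDiff ℝ ∞ (biotSavart W) := by
  refine contDiff_euclidean.2 fun i => ?_
  have e : (fun y => biotSavart W y i) =
      fun y => -((fun x => curl W x i) ⋆[ContinuousLinearMap.lsmul ℝ ℝ, volume] newtonKernel) y :=
    funext fun y => biotSavart_apply_eq_neg_convolution_curl_apply hW hWc y i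
  rw [e]
  have hcurl : ContDiff ℝ ∞ (curl W) := by
    rw [curl_eq_curlCLM_comp]
    exact curlCLM.contDiff.comp (hW.fderiv_right (m := ∞) (by simp))
  have hci : ContDiff ℝ ∞ (fun x => curl W x i) := contDiff_euclidean.1 hcurl i
  have hcic : HasCompactSupport (fun x => curl W x i) :=
    (hasCompactSupport_curl hWc).comp_left (g := fun w : EuclideanSpace ℝ (Fin 3) => w i) rfl
  exact (contDiff_convolution_newtonKernel hci hcic).neg

/-! ### The representation under sub-volume growth -/

/-- **A smooth divergence-free field with compactly supported curl and SUB-VOLUME ball-energy growth is the Biot–Savart field of its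
curl**: `v ∈ C^∞(ℝ³)`, `div v = 0`, `supp (curl v)` compact, `∫_{B_L}|v|² ≤ C L^θ` for `L ≥ L₀` (`C < ∞`, `θ < 3`) ⇒ `v = K₃ ∗ curl v`.
The remainder `w = v − K₃ ∗ curl v` is `C^∞`, curl-free (`curl (K₃ ∗ W) = W`, tree `curl_biotSavart_holds`, using `div curl v = 0`) and
divergence-free (`divergence_biotSavart_holds`), with `∫_{B_L}|w|² ≤ 2 C L^θ + 2‖K₃ ∗ curl v‖₂²` (`eEnergy_biotSavart_lt_top`), so
`Loc.eq_zero_of_curl_eq_zero_of_growth` (harmonic Liouville with growth) kills it. [folklore; MajdaBertozziCUP2002 §2.4.1 Prop. 2.16] -/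
theorem eq_biotSavart_curl_of_growth {v : EuclideanSpace ℝ (Fin 3) → EuclideanSpace ℝ (Fin 3)}
    (hv : ContDiff ℝ ∞ v) (hdiv : VectorCalculus.IsDivFree v) (hWc : HasCompactSupport (curl v))
    {C : ℝ≥0∞} (hC : C ≠ ⊤) {θ L₀ : ℝ} (hθ : θ < 3)
    (hA : ∀ L : ℝ, L₀ ≤ L → ∫⁻ y in ball (0 : EuclideanSpace ℝ (Fin 3)) L, ‖v y‖ₑ ^ 2 ≤ C * ENNReal.ofReal (L ^ θ)) :
    v = biotSavart (curl v) := by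
  set W : EuclideanSpace ℝ (Fin 3) → EuclideanSpace ℝ (Fin 3) := curl v with hWdef
  -- ### regularity of `W` and of `K = K₃ ∗ W`
  have hv1 : ContDiff ℝ 1 v := hv.of_le (by norm_cast)
  have hv2 : ContDiff ℝ 2 v := hv.of_le (by norm_cast)
  have hvd : Differentiable ℝ v := hv1.differentiable one_ne_zero
  have hW : ContDiff ℝ ∞ W := by
    rw [hWdef, curl_eq_curlCLM_comp]
    exact curlCLM.contDiff.comp (hv.fderiv_right (m := ∞) (by simp))
  have hW1 : ContDiff ℝ 1 W := hW.of_le (by norm_cast)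
  have hWcont : Continuous W := hW.continuous
  have hWint : Integrable W := hWcont.integrable_of_hasCompactSupport hWc
  have hDWc : HasCompactSupport (fderiv ℝ W) := hWc.fderiv (𝕜 := ℝ)
  have hDWcont : Continuous (fderiv ℝ W) := hW1.continuous_fderiv one_ne_zero
  have hDWint : Integrable (fun x => fderiv ℝ W x) := hDWcont.integrable_of_hasCompactSupport hDWc
  obtain ⟨M₁, hM₁⟩ := hWcont.bounded_above_of_compact_support hWc
  obtain ⟨M₂, hM₂⟩ := hDWcont.bounded_above_of_compact_support hDWc
  have hbdd : ∃ M : ℝ, ∀ x, ‖W x‖ ≤ M ∧ ‖fderiv ℝ W x‖ ≤ M :=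
    ⟨max M₁ M₂, fun x => ⟨(hM₁ x).trans (le_max_left _ _), (hM₂ x).trans (le_max_right _ _)⟩⟩
  have hdivW : VectorCalculus.IsDivFree W := fun x => divergence_curl_eq_zero_holds v hv2 x
  set K : EuclideanSpace ℝ (Fin 3) → EuclideanSpace ℝ (Fin 3) := biotSavart W with hKdef
  have hK : ContDiff ℝ ∞ K := contDiff_biotSavart_of_contDiff_of_hasCompactSupport hW hWc
  have hKd : Differentiable ℝ K := hK.differentiable (by simp)
  have hcurlK : curl K = W := curl_biotSavart_holds W hW1 hdivW hWint hDWint hbdd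
  have hdivK : VectorCalculus.IsDivFree K := divergence_biotSavart_holds W hW1 hWint hDWint hbdd
  -- ### the remainder `w = v − K`
  set w : EuclideanSpace ℝ (Fin 3) → EuclideanSpace ℝ (Fin 3) := fun y => v y - K y with hwdef
  have hw : ContDiff ℝ ∞ w := hv.sub hK
  have hw2 : ContDiff ℝ 2 w := hw.of_le (by norm_cast)
  have hcurlw : ∀ x, curl w x = 0 := fun x => by
    rw [hwdef, curl_sub (hvd x) (hKd x), hcurlK, hWdef, sub_self]
  have hdivw : VectorCalculus.IsDivFree w := fun x => by
    unfold VectorCalculus.divergence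
    rw [hwdef, fderiv_fun_sub (hvd x) (hKd x), ContinuousLinearMap.toLinearMap_sub, map_sub]
    have h1 := hdiv x
    have h2 := hdivK x
    unfold VectorCalculus.divergence at h1 h2
    rw [h1, h2, sub_self]
  -- ### the energy of `K` is finite
  obtain ⟨R₀, hR₀⟩ := hWc.isCompact.isBounded.subset_closedBall (0 : EuclideanSpace ℝ (Fin 3))
  have hsuppW : Function.support W ⊆ closedBall (0 : EuclideanSpace ℝ (Fin 3)) (max R₀ 1) :=
    (subset_tsupport W).trans (hR₀.trans (closedBall_subset_closedBall (le_max_left _ _)))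
  have hEK : eEnergy K < ⊤ :=
    eEnergy_biotSavart_lt_top (lt_of_lt_of_le one_pos (le_max_right _ _)) hM₁ hsuppW
  set EK : ℝ≥0∞ := eEnergy K with hEKdef
  -- ### growth of `w`: `∫_{B_L}|w|² ≤ 2 C L^θ + 2 E_K ≤ (2C + 2E_K) L^{θ₊}` for `L ≥ max L₀ 1`
  have hpt : ∀ y, ‖w y‖ₑ ^ 2 ≤ 2 * ‖v y‖ₑ ^ 2 + 2 * ‖K y‖ₑ ^ 2 := by
    intro y
    have h : ‖v y - K y‖ ^ 2 ≤ 2 * ‖v y‖ ^ 2 + 2 * ‖K y‖ ^ 2 :=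
      calc ‖v y - K y‖ ^ 2 ≤ (‖v y‖ + ‖K y‖) ^ 2 := pow_le_pow_left₀ (norm_nonneg _) (norm_sub_le _ _) 2
        _ ≤ 2 * ‖v y‖ ^ 2 + 2 * ‖K y‖ ^ 2 := by nlinarith [sq_nonneg (‖v y‖ - ‖K y‖)]
    calc ‖w y‖ₑ ^ 2 = ENNReal.ofReal (‖v y - K y‖ ^ 2) := by
          rw [hwdef, ← ofReal_norm, ENNReal.ofReal_pow (norm_nonneg _)]
      _ ≤ ENNReal.ofReal (2 * ‖v y‖ ^ 2 + 2 * ‖K y‖ ^ 2) := ENNReal.ofReal_le_ofReal h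
      _ = 2 * ‖v y‖ₑ ^ 2 + 2 * ‖K y‖ₑ ^ 2 := by
          rw [ENNReal.ofReal_add (by positivity) (by positivity), ENNReal.ofReal_mul zero_le_two,
            ENNReal.ofReal_mul zero_le_two, ENNReal.ofReal_pow (norm_nonneg _), ENNReal.ofReal_pow (norm_nonneg _),
            ofReal_norm, ofReal_norm, ENNReal.ofReal_ofNat]
  set θ' : ℝ := max θ 0 with hθ'
  have hθ'3 : θ' < 3 := max_lt hθ (by norm_num)
  have hgrowth : ∀ L : ℝ, max L₀ 1 ≤ L →
      ∫⁻ y in ball (0 : EuclideanSpace ℝ (Fin 3)) L, ‖w y‖ₑ ^ 2 ≤ (2 * C + 2 * EK) * ENNReal.ofReal (L ^ θ') := by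
    intro L hL
    have hL1 : 1 ≤ L := (le_max_right _ _).trans hL
    have hL0 : 0 < L := by linarith
    have hKm : AEMeasurable (fun y => ‖K y‖ₑ ^ 2) (volume.restrict (ball (0 : EuclideanSpace ℝ (Fin 3)) L)) :=
      (hK.continuous.aestronglyMeasurable.enorm.pow_const 2).restrict
    have hLθ : ENNReal.ofReal (L ^ θ) ≤ ENNReal.ofReal (L ^ θ') :=
      ENNReal.ofReal_le_ofReal (Real.rpow_le_rpow_of_exponent_le hL1 (le_max_left _ _))
    have h1θ : (1 : ℝ≥0∞) ≤ ENNReal.ofReal (L ^ θ') := by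
      rw [← ENNReal.ofReal_one]; exact ENNReal.ofReal_le_ofReal (Real.one_le_rpow hL1 (le_max_right _ _))
    calc ∫⁻ y in ball (0 : EuclideanSpace ℝ (Fin 3)) L, ‖w y‖ₑ ^ 2
        ≤ ∫⁻ y in ball (0 : EuclideanSpace ℝ (Fin 3)) L, (2 * ‖v y‖ₑ ^ 2 + 2 * ‖K y‖ₑ ^ 2) := lintegral_mono fun y => hpt y
      _ = (2 * ∫⁻ y in ball (0 : EuclideanSpace ℝ (Fin 3)) L, ‖v y‖ₑ ^ 2) +
            2 * ∫⁻ y in ball (0 : EuclideanSpace ℝ (Fin 3)) L, ‖K y‖ₑ ^ 2 := by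
          rw [lintegral_add_right' _ (hKm.const_mul _), lintegral_const_mul' _ _ ENNReal.ofNat_ne_top,
            lintegral_const_mul'' _ hKm]
      _ ≤ 2 * (C * ENNReal.ofReal (L ^ θ)) + 2 * EK :=
          add_le_add (mul_le_mul' le_rfl (hA L ((le_max_left _ _).trans hL)))
            (mul_le_mul' le_rfl (setLIntegral_le_lintegral _ _))
      _ ≤ 2 * (C * ENNReal.ofReal (L ^ θ')) + 2 * EK * ENNReal.ofReal (L ^ θ') := by
          have h1 : 2 * (C * ENNReal.ofReal (L ^ θ)) ≤ 2 * (C * ENNReal.ofReal (L ^ θ')) :=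
            mul_le_mul' le_rfl (mul_le_mul' le_rfl hLθ)
          have h2 : 2 * EK ≤ 2 * EK * ENNReal.ofReal (L ^ θ') :=
            calc 2 * EK = 2 * EK * 1 := (mul_one _).symm
              _ ≤ 2 * EK * ENNReal.ofReal (L ^ θ') := mul_le_mul' le_rfl h1θ
          exact add_le_add h1 h2
      _ = (2 * C + 2 * EK) * ENNReal.ofReal (L ^ θ') := by ring
  -- all scales (the remainder is continuous) and the Liouville endgame
  have hC2 : 2 * C + 2 * EK ≠ ⊤ :=
    ENNReal.add_ne_top.2 ⟨ENNReal.mul_ne_top ENNReal.ofNat_ne_top hC, ENNReal.mul_ne_top ENNReal.ofNat_ne_top hEK.ne⟩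
  obtain ⟨C', hC', hgrowth'⟩ := Shifted.growth_of_growth_le hw.continuous hθ'3.le (le_max_right L₀ 1) hC2 hgrowth
  have hw0 : w = 0 := Loc.eq_zero_of_curl_eq_zero_of_growth hw2 hcurlw hdivw hC' hθ'3 hgrowth'
  funext y
  have := congrFun hw0 y
  simp only [hwdef, Pi.zero_apply, sub_eq_zero] at this
  rw [this]

/-! ### Member level: the slices of a classical compact-vortex member are their Biot–Savart fields -/

/-- **THE SLICE OF A CLASSICAL MEMBER WITH COMPACTLY SUPPORTED VORTICITY IS ITS OWN BIOT–SAVART FIELD** (of the crux hypotheses only the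
power gauges are used — in fact only `A` —, any `ρ ≥ 0`; plus `IsClassicalEulerSolutionOn (Iio 0) 0 u p`): for `τ < 0` with
`curl (u τ)` compactly supported, `u τ = biotSavart (curl (u τ))`.  The decay at infinity is supplied by the `A`-gauge: for `a ≥ 1 − τ` the slice
`τ` lies in `(−a², 0)`, so `∫_{B_a}|u(τ)|² ≤ a·A(a) ≤ c a^{1−2ρ}` (`1 − 2ρ < 3`), and `eq_biotSavart_curl_of_growth` applies.  This is
`Sig.stub_biotSavartSlice` of the line `vortex-volume` with `InClass` unfolded (its first two components are not needed).
[folklore; MajdaBertozziCUP2002 §2.4.1 Prop. 2.16] -/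
theorem slice_eq_biotSavart_curl {ρ : ℝ} (hρ : 0 ≤ ρ)
    {u : ℝ → EuclideanSpace ℝ (Fin 3) → EuclideanSpace ℝ (Fin 3)} {p : ℝ → EuclideanSpace ℝ (Fin 3) → ℝ}
    {H : ℝ → EuclideanSpace ℝ (Fin 3) → EuclideanSpace ℝ (Fin 3) →L[ℝ] EuclideanSpace ℝ (Fin 3)} {c : ℝ≥0}
    (hgauge : ∀ a : ℝ, 0 < a →
      ENNReal.ofReal (a ^ (2 * ρ)) * cknA a (0 : ℝ × EuclideanSpace ℝ (Fin 3)) u +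
          ENNReal.ofReal (a ^ ρ) * cknE a (0 : ℝ × EuclideanSpace ℝ (Fin 3)) H +
        ENNReal.ofReal (a ^ (2 * ρ)) * cknD a (0 : ℝ × EuclideanSpace ℝ (Fin 3)) p ≤ (c : ℝ≥0∞))
    (hcl : IsClassicalEulerSolutionOn (Iio 0) 0 u p)
    {τ : ℝ} (hτ : τ < 0) (hW : HasCompactSupport (curl (u τ))) :
    u τ = biotSavart (curl (u τ)) := by
  have hA : ∀ a : ℝ, 0 < a → ENNReal.ofReal (a ^ (2 * ρ)) *
      cknA a (0 : ℝ × EuclideanSpace ℝ (Fin 3)) u ≤ (c : ℝ≥0∞) :=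
    fun a ha => le_trans (le_trans le_self_add le_self_add) (hgauge a ha)
  have hv : ContDiff ℝ ∞ (u τ) := hcl.contDiff_velocity hτ
  have hdiv : VectorCalculus.IsDivFree (u τ) := hcl.divFree τ hτ
  -- the `A`-gauge on the slice `τ ∈ (−a², 0)` for `a ≥ 1 − τ`
  have hgrowth : ∀ a : ℝ, 1 - τ ≤ a →
      ∫⁻ y in ball (0 : EuclideanSpace ℝ (Fin 3)) a, ‖u τ y‖ₑ ^ 2 ≤ (c : ℝ≥0∞) * ENNReal.ofReal (a ^ (1 - 2 * ρ)) := by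
    intro a ha
    have ha1 : 1 ≤ a := by linarith
    have ha0 : 0 < a := by linarith
    have ha2 : -(a ^ 2) < τ := by nlinarith
    have hτI : τ ∈ Ioo ((0 : ℝ × EuclideanSpace ℝ (Fin 3)).1 - a ^ 2) (0 : ℝ × EuclideanSpace ℝ (Fin 3)).1 := by
      simp only [Prod.fst_zero, zero_sub, mem_Ioo]
      exact ⟨ha2, hτ⟩
    have hslice : (ENNReal.ofReal a)⁻¹ * ∫⁻ x in ball (0 : EuclideanSpace ℝ (Fin 3)) a, ‖u τ x‖ₑ ^ 2 ≤
        cknA a (0 : ℝ × EuclideanSpace ℝ (Fin 3)) u := by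
      unfold cknA
      exact le_iSup₂ (f := fun t (_ : t ∈ Ioo ((0 : ℝ × EuclideanSpace ℝ (Fin 3)).1 - a ^ 2)
          (0 : ℝ × EuclideanSpace ℝ (Fin 3)).1) =>
          (ENNReal.ofReal a)⁻¹ * ∫⁻ x in ball (0 : ℝ × EuclideanSpace ℝ (Fin 3)).2 a, ‖u t x‖ₑ ^ 2) τ hτI
    set I : ℝ≥0∞ := ∫⁻ x in ball (0 : EuclideanSpace ℝ (Fin 3)) a, ‖u τ x‖ₑ ^ 2 with hI
    have hg : ENNReal.ofReal (a ^ (2 * ρ)) * ((ENNReal.ofReal a)⁻¹ * I) ≤ (c : ℝ≥0∞) :=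
      calc ENNReal.ofReal (a ^ (2 * ρ)) * ((ENNReal.ofReal a)⁻¹ * I)
          ≤ ENNReal.ofReal (a ^ (2 * ρ)) * cknA a (0 : ℝ × EuclideanSpace ℝ (Fin 3)) u := by gcongr
        _ ≤ (c : ℝ≥0∞) := hA a ha0
    have hKa : ENNReal.ofReal (a ^ (2 * ρ)) * (ENNReal.ofReal a)⁻¹ = ENNReal.ofReal (a ^ (2 * ρ - 1)) := by
      rw [← ENNReal.ofReal_inv_of_pos ha0, ← ENNReal.ofReal_mul (by positivity), Real.rpow_sub_one ha0.ne',
        div_eq_mul_inv]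
    have hunit : ENNReal.ofReal (a ^ (1 - 2 * ρ)) * ENNReal.ofReal (a ^ (2 * ρ - 1)) = 1 := by
      rw [← ENNReal.ofReal_mul (by positivity), ← Real.rpow_add ha0, show (1 - 2 * ρ) + (2 * ρ - 1) = 0 by ring,
        Real.rpow_zero, ENNReal.ofReal_one]
    calc I = ENNReal.ofReal (a ^ (1 - 2 * ρ)) * (ENNReal.ofReal (a ^ (2 * ρ - 1)) * I) := by
          rw [← mul_assoc, hunit, one_mul]
      _ = ENNReal.ofReal (a ^ (1 - 2 * ρ)) * (ENNReal.ofReal (a ^ (2 * ρ)) * ((ENNReal.ofReal a)⁻¹ * I)) := by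
          rw [← mul_assoc (ENNReal.ofReal (a ^ (2 * ρ))), hKa]
      _ ≤ ENNReal.ofReal (a ^ (1 - 2 * ρ)) * (c : ℝ≥0∞) := by gcongr
      _ = (c : ℝ≥0∞) * ENNReal.ofReal (a ^ (1 - 2 * ρ)) := mul_comm _ _
  exact eq_biotSavart_curl_of_growth hv hdiv hW ENNReal.coe_ne_top (θ := 1 - 2 * ρ) (by linarith) hgrowth

end CompactVortex

end Summit.NavierStokesRegularity.NavierStokesRegularity.Theorems.PowerGaugeEulerLiouville
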